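import Mathlib
import Summits.KontsevichZagierPeriods.Zeta5Search.TS3RayCellsA
import Summits.KontsevichZagierPeriods.Zeta5Search.TS3RayCellsB
import Summits.KontsevichZagierPeriods.Zeta5Search.TS3RayCellsC
import Summits.KontsevichZagierPeriods.Zeta5Search.TS3RayCellsD
import Summits.KontsevichZagierPeriods.Zeta5Search.TS3RayCellsE
import Summits.KontsevichZagierPeriods.Zeta5Search.TS3RayCellsF
import Summits.KontsevichZagierPeriods.Zeta5Search.TS3RayCellsG
import Summits.KontsevichZagierPeriods.Zeta5Search.TS3RayCellsH
import Summits.KontsevichZagierPeriods.Zeta5Search.TS3RayCellsI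
import Summits.KontsevichZagierPeriods.Zeta5Search.TS3RayCellsJ
import Summits.KontsevichZagierPeriods.Zeta5Search.TS3RayCellsK
import Summits.KontsevichZagierPeriods.Zeta5Search.TS3RayCellsL
import Summits.KontsevichZagierPeriods.Zeta5Search.TS3RayCellsM
import Summits.KontsevichZagierPeriods.Zeta5Search.FlagRayDominance
import Summits.KontsevichZagierPeriods.Zeta5Search.ValuationLawsAboveB0
import HarnessLib

/-!
# ζ(5) search — the Casoratian class bound and the bonus rungs on EVERY first-period θ-cell of TOP_STAIR #3, all `n`, every direction `j`

Cell `pub-zeta5` (HONEST FRAMING: systematic search; no irrationality claim unless certified), TRACK «DENOM-LAW» D1 prover seat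
(denom-prover-d1 g14, `HOME/denom-law/prover-d1/ATTEMPT-14.md`).  TOP_STAIR #3 is the census direction `a = (18,32,23,30,28,38,43,30)` — the
TOP_STAIR ray with the largest staircase saving (`δ_28 = 195` vs `δ_stair = 191`) — with dual ray `b(n) = n·(85; 35,32,30,27,25,22,20) = bRay ts3 n`
(`b₀ = 85n`, `d = 64n`; the 28 Brown–Zudilin forms are `< 2p` iff `p > 21.5n` = the first period).  From the machine-generated class-type covers
`TS3RayCellsA–M` (all `n ≥ 1`): §0 the ray kit for EVERY contiguity index `j` (shifts in the polytope, window facts for `p > 21.5n`, THEOREM LB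
`cas_ge_casLB`); §1 the value of the tree's class bound cell by cell — `casLB ≥ −11, −9, −7, −9, −9, −7, −7, −5, −5, −3, −1, −1, 0, 1, 0` on
`(21.5,23], (23,28], (28,85/3], (85/3,30], (30,31], (31,32], (32,33], (33,35], (35,36], (36,38], (38,40], (40,41], (41,43], (43,64], (64,85]`
(all attained in the samples `n ≤ 24`: `HOME/…/g14/tables/ts3_cells_n24.txt`); §2 the five cells where the PATH-accounting value exceeds `casLB`, each
by a LANDED generic rung read on the cover for any `j`: the DOUBLE DROP (`StairFLAG.cover_B_j`, `N = 6`) on `85n < 3p ≤ 90n` and `30n < p ≤ 31n`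
(`v ≥ −7 = casLB + 2`), the COLLINEARITY RUNG (`ClassTypeGuardsO.rungO_of_cover`, `N = 5`, keys `[−1,−4]`, `[−2,−3]`, moment range `4p ≤ 128n + 3`)
on `31n < p ≤ 32n` (`v ≥ −6 = casLB + 1`), the LEMMA-D bonus (`ClassTypeGuards.lemmaD_of_cover`, `m = −4`) on `35n < p ≤ 36n` (`v ≥ −4 = casLB + 1`;
the tree's `StairCellTS3b` is the open window, `j = 7`), and THEOREM V (`padicNorm_coeffV_le_pairFloors`: `v(V) ≥ −N_p = −1` beats `VB = −2`, via
`VCarrierAggregate.cas_val_ge_of_coeffV`) on `40n < p ≤ 41n` (`v ≥ 0 = casLB + 1`).  Consumed by `DenomLaw/TS3RayPath` (the PATH ACCOUNTING node on the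
whole first period of TOP_STAIR #3).  MODEL/structure-side integer bookkeeping on the cell's own class data; nothing about ζ(5); no γ; records in print UNMOVED.
-/

open Finset

namespace Summit.KontsevichZagierPeriods.Zeta5Search.StairTS3

open Summit.KontsevichZagierPeriods.Zeta5Search.ClusterValuation
open Summit.KontsevichZagierPeriods.Zeta5Search.CasoratianValuation (InPolytope shift casoratian pairFloors refund)
open Summit.KontsevichZagierPeriods.Zeta5Search.WedgeDictionary (dOf coeffV)
open Summit.KontsevichZagierPeriods.Zeta5Search.ClassTypeCover
open Summit.KontsevichZagierPeriods.Zeta5Search.StaircaseCells (bRay ts3)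
open Summit.KontsevichZagierPeriods.Zeta5Search.StairFLAG (casLB_of_cover' cover_B_j)

/-! ## §0 Ray kit (every `j`) -/

/-- `b₀ = 85n`. -/
theorem w0 (n : ℕ) : bRay ts3 n 0 = 85 * (n : ℤ) := by rw [v0]; push_cast; ring
/-- `b₁ = 35n`. -/
theorem w1 (n : ℕ) : bRay ts3 n 1 = 35 * (n : ℤ) := by rw [v1]; push_cast; ring
/-- `b₂ = 32n`. -/
theorem w2 (n : ℕ) : bRay ts3 n 2 = 32 * (n : ℤ) := by rw [v2]; push_cast; ring
/-- `b₃ = 30n`. -/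
theorem w3 (n : ℕ) : bRay ts3 n 3 = 30 * (n : ℤ) := by rw [v3]; push_cast; ring
/-- `b₄ = 27n`. -/
theorem w4 (n : ℕ) : bRay ts3 n 4 = 27 * (n : ℤ) := by rw [v4]; push_cast; ring
/-- `b₅ = 25n`. -/
theorem w5 (n : ℕ) : bRay ts3 n 5 = 25 * (n : ℤ) := by rw [v5]; push_cast; ring
/-- `b₆ = 22n`. -/
theorem w6 (n : ℕ) : bRay ts3 n 6 = 22 * (n : ℤ) := by rw [v6]; push_cast; ring
/-- `b₇ = 20n`. -/
theorem w7 (n : ℕ) : bRay ts3 n 7 = 20 * (n : ℤ) := by rw [v7]; push_cast; ring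

/-- `d = 3b₀ − Σ b_i = 64n`. -/
theorem dOf_ts3 (n : ℕ) : dOf (bRay ts3 n) = 64 * (n : ℤ) := by rw [dOf_ray]; push_cast; ring

/-- **Every contiguous shift `b(n) + e_j` lies in the polytope** (`n ≥ 1`, `1 ≤ j ≤ 7`; the kit's `inPolytope_shift_ray` is `j = 7`). -/
theorem inPolytope_shift_ts3_j {n : ℕ} (hn : 1 ≤ n) (j : ℕ) (hj1 : 1 ≤ j) (hj7 : j ≤ 7) :
    InPolytope (shift (bRay ts3 n) j) := by
  have hs : ∀ i, shift (bRay ts3 n) j i = if i = j then bRay ts3 n j + 1 else bRay ts3 n i := by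
    intro i; simp only [shift, Function.update_apply]
  interval_cases j <;>
  · refine ⟨⟨?_, ?_⟩, ?_, ?_⟩
    · rw [hs]; simp only [Nat.reduceEqDiff, if_false, w0]; positivity
    · intro i hi
      simp only [Finset.mem_range] at hi
      interval_cases i <;> simp only [hs, Nat.reduceAdd, Nat.reduceEqDiff, if_true, if_false, w0, w1, w2, w3, w4, w5, w6, w7] <;> omega
    · intro i hi
      simp only [Finset.mem_range] at hi
      interval_cases i <;> simp only [hs, Nat.reduceAdd, Nat.reduceEqDiff, if_true, if_false, w0, w1, w2, w3, w4, w5, w6, w7] <;> omega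
    · simp only [Finset.sum_range_succ, Finset.sum_range_zero, zero_add, Nat.reduceAdd, hs, Nat.reduceEqDiff, if_true, if_false,
        w0, w1, w2, w3, w4, w5, w6, w7]; omega

/-- Window facts for the first period `43n < 2p` (`n ≥ 1`): `5 ≤ p` and `b₀ + 2 < p²`. -/
theorem window43 {n p : ℕ} (hn : 1 ≤ n) (h : 43 * n < 2 * p) :
    5 ≤ p ∧ (bRay ts3 n 0 + 2 : ℤ) < (p : ℤ) ^ 2 := by
  refine ⟨by omega, ?_⟩
  rw [w0]
  have h2 : (43 * n + 1 : ℤ) ≤ 2 * p := by exact_mod_cast (show 43 * n + 1 ≤ 2 * p by omega)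
  have hp22 : (22 : ℤ) ≤ p := by exact_mod_cast (show 22 ≤ p by omega)
  have hn1 : (1 : ℤ) ≤ n := by exact_mod_cast hn
  nlinarith

/-- Every first-period prime is odd. -/
theorem odd_of_prime_gt43 {n p : ℕ} (hprime : p.Prime) (h : 43 * n < 2 * p) (hn : 1 ≤ n) : p % 2 = 1 :=
  Nat.odd_iff.1 (hprime.odd_of_ne_two (by omega))

/-- `p ≤ d = 64n`. -/
theorem le_dOf_ts3 {n p : ℕ} (h : p ≤ 64 * n) : (p : ℤ) ≤ dOf (bRay ts3 n) := by
  rw [dOf_ts3]; exact_mod_cast h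

/-- `p ≤ b₀ = 85n`. -/
theorem le_b0_ts3 {n p : ℕ} (h : p ≤ 85 * n) : (p : ℤ) ≤ bRay ts3 n 0 := by
  rw [w0]; exact_mod_cast h

/-- **THEOREM LB on the ray, any direction `j`**: `casLB(b(n),p) ≤ v_p(Cas_j(b(n)))` for `43n < 2p`. -/
theorem cas_ge_casLB {n j p : ℕ} (hn : 1 ≤ n) (hj1 : 1 ≤ j) (hj7 : j ≤ 7) (hprime : p.Prime) (h : 43 * n < 2 * p)
    (hcas : casoratian (bRay ts3 n) j ≠ 0) :
    casLB (bRay ts3 n) p ≤ padicValRat p (casoratian (bRay ts3 n) j) := by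
  obtain ⟨hp5, hwin⟩ := window43 hn h
  exact casoratianClassBound_holds _ j p (inPolytope_ray n) hj1 hj7 (inPolytope_shift_ts3_j hn j hj1 hj7) hprime hp5 hwin hcas

/-- The parity flag of `b₀ = 85n` for even `n`. -/
theorem oddFlag_even {n : ℕ} (h : n % 2 = 0) : decide (¬ (2 : ℤ) ∣ bRay ts3 n 0) = false := by
  rw [oddFlag n h]; decide

/-- The parity flag of `b₀ = 85n` for odd `n`. -/
theorem oddFlag_odd {n : ℕ} (h : n % 2 = 1) : decide (¬ (2 : ℤ) ∣ bRay ts3 n 0) = true := by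
  rw [oddFlag n h]; decide

/-! ## §1 `casLB` cell by cell (from the covers; `d = 64n`) -/

section Cells
variable {n p : ℕ} [Fact p.Prime]

/-- `(21.5,23]`: `casLB ≥ −11`. -/
theorem casLB_c21 (hA : 43 * n < 2 * p) (hB : 1 * p ≤ 23 * n) (hp2 : p % 2 = 1) :
    (-11 : ℤ) ≤ casLB (bRay ts3 n) p := by
  rcases casLB_of_cover' (cover_c21 hA hB hp2) (checkM_c21 _) (by norm_num)
    (fun h => absurd h (by rw [dOf_ts3]; omega)) with ⟨h0, -⟩ | h
  · rw [h0]; norm_num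
  · linarith

/-- `(23,28]`: `casLB ≥ −9`. -/
theorem casLB_c23 (hA : 23 * n < 1 * p) (hB : 1 * p ≤ 28 * n) (hp2 : p % 2 = 1) :
    (-9 : ℤ) ≤ casLB (bRay ts3 n) p := by
  rcases casLB_of_cover' (cover_c23 hA hB hp2) (checkM_c23 _) (by norm_num)
    (fun h => absurd h (by rw [dOf_ts3]; omega)) with ⟨h0, -⟩ | h
  · rw [h0]; norm_num
  · linarith

/-- `(28,85/3]`: `casLB ≥ −7`. -/
theorem casLB_c28a (hA : 28 * n < 1 * p) (hB : 3 * p ≤ 85 * n) (hp2 : p % 2 = 1) :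
    (-7 : ℤ) ≤ casLB (bRay ts3 n) p := by
  rcases casLB_of_cover' (cover_c28a hA hB hp2) (checkM_c28a _) (by norm_num)
    (fun h => absurd h (by rw [dOf_ts3]; omega)) with ⟨h0, -⟩ | h
  · rw [h0]; norm_num
  · linarith

/-- `(85/3,30]`: `casLB ≥ −9` (parity-split covers; the even-`n` checks are LITERALLY TOP_STAIR #1's `StairTS1.checkM_c11b` — same type list). -/
theorem casLB_c28b (hA : 85 * n < 3 * p) (hB : 1 * p ≤ 30 * n) (hp2 : p % 2 = 1) :
    (-9 : ℤ) ≤ casLB (bRay ts3 n) p := by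
  by_cases hn2 : n % 2 = 0
  · rcases casLB_of_cover' (cover_c28b_ev hA hB hp2 hn2) (by rw [oddFlag_even hn2]; exact StairTS1.checkM_c11b) (by norm_num)
      (fun h => absurd h (by rw [dOf_ts3]; omega)) with ⟨h0, -⟩ | h
    · rw [h0]; norm_num
    · linarith
  · have hn1 : n % 2 = 1 := by omega
    rcases casLB_of_cover' (cover_c28b_od hA hB hp2 hn1) (by rw [oddFlag_odd hn1]; exact checkM_c28b_od) (by norm_num)
      (fun h => absurd h (by rw [dOf_ts3]; omega)) with ⟨h0, -⟩ | h
    · rw [h0]; norm_num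
    · linarith

/-- `(30,31]`: `casLB ≥ −9` (parity-split covers). -/
theorem casLB_c30 (hA : 30 * n < 1 * p) (hB : 1 * p ≤ 31 * n) (hp2 : p % 2 = 1) :
    (-9 : ℤ) ≤ casLB (bRay ts3 n) p := by
  by_cases hn2 : n % 2 = 0
  · rcases casLB_of_cover' (cover_c30_ev hA hB hp2 hn2) (by rw [oddFlag_even hn2]; exact checkM_c30_ev) (by norm_num)
      (fun h => absurd h (by rw [dOf_ts3]; omega)) with ⟨h0, -⟩ | h
    · rw [h0]; norm_num
    · linarith
  · have hn1 : n % 2 = 1 := by omega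
    rcases casLB_of_cover' (cover_c30_od hA hB hp2 hn1) (by rw [oddFlag_odd hn1]; exact checkM_c30_od) (by norm_num)
      (fun h => absurd h (by rw [dOf_ts3]; omega)) with ⟨h0, -⟩ | h
    · rw [h0]; norm_num
    · linarith

/-- `(31,32]`: `casLB ≥ −7`. -/
theorem casLB_c31 (hA : 31 * n < 1 * p) (hB : 1 * p ≤ 32 * n) (hp2 : p % 2 = 1) :
    (-7 : ℤ) ≤ casLB (bRay ts3 n) p := by
  rcases casLB_of_cover' (cover_c31 hA hB hp2) (checkM_c31 _) (by norm_num)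
    (fun h => absurd h (by rw [dOf_ts3]; omega)) with ⟨h0, -⟩ | h
  · rw [h0]; norm_num
  · linarith

/-- `(32,33]`: `casLB ≥ −7`. -/
theorem casLB_c32 (hA : 32 * n < 1 * p) (hB : 1 * p ≤ 33 * n) (hp2 : p % 2 = 1) :
    (-7 : ℤ) ≤ casLB (bRay ts3 n) p := by
  rcases casLB_of_cover' (cover_c32 hA hB hp2) (checkM_c32 _) (by norm_num)
    (fun h => absurd h (by rw [dOf_ts3]; omega)) with ⟨h0, -⟩ | h
  · rw [h0]; norm_num
  · linarith

/-- `(33,35]`: `casLB ≥ −5`. -/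
theorem casLB_c33 (hA : 33 * n < 1 * p) (hB : 1 * p ≤ 35 * n) (hp2 : p % 2 = 1) :
    (-5 : ℤ) ≤ casLB (bRay ts3 n) p := by
  rcases casLB_of_cover' (cover_c33 hA hB hp2) (checkM_c33 _) (by norm_num)
    (fun h => absurd h (by rw [dOf_ts3]; omega)) with ⟨h0, -⟩ | h
  · rw [h0]; norm_num
  · linarith

/-- `(35,36]`: `casLB ≥ −5`. -/
theorem casLB_c35 (hA : 35 * n < 1 * p) (hB : 1 * p ≤ 36 * n) (hp2 : p % 2 = 1) :
    (-5 : ℤ) ≤ casLB (bRay ts3 n) p := by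
  rcases casLB_of_cover' (cover_c35 hA hB hp2) (checkM_c35 _) (by norm_num)
    (fun h => absurd h (by rw [dOf_ts3]; omega)) with ⟨h0, -⟩ | h
  · rw [h0]; norm_num
  · linarith

/-- `(36,38]`: `casLB ≥ −3` (the STAIR cell of `StairCellTS3a`, here with the closed endpoint). -/
theorem casLB_c36 (hA : 36 * n < 1 * p) (hB : 1 * p ≤ 38 * n) (hp2 : p % 2 = 1) :
    (-3 : ℤ) ≤ casLB (bRay ts3 n) p := by
  rcases casLB_of_cover' (cover_c36 hA hB hp2) (checkM_c36 _) (by norm_num)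
    (fun h => absurd h (by rw [dOf_ts3]; omega)) with ⟨h0, -⟩ | h
  · rw [h0]; norm_num
  · linarith

/-- `(38,40]`: `casLB ≥ −1`. -/
theorem casLB_c38 (hA : 38 * n < 1 * p) (hB : 1 * p ≤ 40 * n) (hp2 : p % 2 = 1) :
    (-1 : ℤ) ≤ casLB (bRay ts3 n) p := by
  rcases casLB_of_cover' (cover_c38 hA hB hp2) (checkM_c38 _) (by norm_num)
    (fun h => absurd h (by rw [dOf_ts3]; omega)) with ⟨h0, -⟩ | h
  · rw [h0]; norm_num
  · linarith

/-- `(40,41]`: `casLB ≥ −1`. -/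
theorem casLB_c40 (hA : 40 * n < 1 * p) (hB : 1 * p ≤ 41 * n) (hp2 : p % 2 = 1) :
    (-1 : ℤ) ≤ casLB (bRay ts3 n) p := by
  rcases casLB_of_cover' (cover_c40 hA hB hp2) (checkM_c40 _) (by norm_num)
    (fun h => absurd h (by rw [dOf_ts3]; omega)) with ⟨h0, -⟩ | h
  · rw [h0]; norm_num
  · linarith

/-- `(41,43]`: `casLB ≥ 0`. -/
theorem casLB_c41 (hA : 41 * n < 1 * p) (hB : 1 * p ≤ 43 * n) (hp2 : p % 2 = 1) :
    (0 : ℤ) ≤ casLB (bRay ts3 n) p := by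
  rcases casLB_of_cover' (cover_c41 hA hB hp2) (checkM_c41 _) (by norm_num)
    (fun h => absurd h (by rw [dOf_ts3]; omega)) with ⟨h0, -⟩ | h
  · rw [h0]
  · linarith

/-- `(43,64]`: `casLB ≥ 1` (the class of `22n` — type `[−1, 1]` for `p ≤ 63n`, `[−1]` beyond — has a pole, so the no-pole alternative is excluded). -/
theorem casLB_c43 (hA : 43 * n < 1 * p) (hB : 1 * p ≤ 64 * n) (hp2 : p % 2 = 1) :
    (1 : ℤ) ≤ casLB (bRay ts3 n) p := by
  rcases casLB_of_cover' (cover_c43 hA hB hp2) (checkM_c43 _) (by norm_num)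
    (fun h => absurd h (by rw [dOf_ts3]; omega)) with ⟨-, h0⟩ | h
  · exfalso
    have h1 := h0 (22 * n) (by omega)
    by_cases h63 : p ≤ 63 * n
    · have ht := iv_c43_12 (n := n) (p := p) (x := 22 * n) hA hB (by omega) (by omega) (by omega) (by omega) (by omega) (by omega)
      rw [ht.classPoleCount_eq] at h1
      revert h1; decide
    · have ht := iv_c43_19 (n := n) (p := p) (x := 22 * n) hA hB (by omega) (by omega) (by omega) (by omega) (by omega)
      rw [ht.classPoleCount_eq] at h1
      revert h1; decide
  · linarith

/-- `(64,85]` (`p > d`): `casLB ≥ 0`. -/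
theorem casLB_c64 (hA : 64 * n < 1 * p) (hB : 1 * p ≤ 85 * n) (hp2 : p % 2 = 1) :
    (0 : ℤ) ≤ casLB (bRay ts3 n) p := by
  rcases casLB_of_cover' (cover_c64 hA hB hp2) (checkM_c64 _) (by norm_num) (fun _ => le_rfl)
    with ⟨h0, -⟩ | h
  · rw [h0]
  · linarith

end Cells

/-! ## §2 The five bonus cells, any direction `j` -/

/-- **The collinearity rung (rung O) on the ray, any direction `j`** (`ClassTypeGuardsO.rungO_of_cover` with its fallback; as g13's `StairTS1.cover_O_j`):
`c ≤ v_p(Cas_j(b(n)))` from a cover of `b(n)`, `checkLB` at `(−N, B)` with `c ≤ −N + B + 1`, `checkO` at `N` (`N ≥ 3` odd, two keys) inside the moment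
range `(N−1)p + 2 ≤ 2d + 3`, and the fallback `checkLBx` at `(−N; A', B')` with `c ≤ A' + B'`. -/
theorem cover_O_ts3 {n p j : ℕ} (hn : 1 ≤ n) (hj1 : 1 ≤ j) (hj7 : j ≤ 7) (hpr : p.Prime)
    (hp5 : 5 ≤ p) (hpb : (p : ℤ) ≤ bRay ts3 n 0) (hpd : (p : ℤ) ≤ dOf (bRay ts3 n)) (hwin : (bRay ts3 n 0 + 2 : ℤ) < (p : ℤ) ^ 2)
    {TY : List (List ℤ × Bool)} (hcov : Cover (bRay ts3 n) p TY) {N : ℕ} (hN : 3 ≤ N) (hodd : N % 2 = 1)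
    (hrange : ((N : ℤ) - 1) * p + 2 ≤ 2 * dOf (bRay ts3 n) + 3) {K₁ K₂ : Bool × List ℤ} {B A' B' c : ℤ}
    (hLB : checkLB (decide (¬ (2 : ℤ) ∣ bRay ts3 n 0)) TY (-(N : ℤ)) B = true) (hB1 : B ≤ 1)
    (hO : checkO (decide (¬ (2 : ℤ) ∣ bRay ts3 n 0)) TY N K₁ K₂ = true)
    (hLBx : checkLBx (decide (¬ (2 : ℤ) ∣ bRay ts3 n 0)) TY (-(N : ℤ)) A' B' = true) (hB1' : B' ≤ 1)
    (hc : c ≤ -(N : ℤ) + B + 1) (hc' : c ≤ A' + B') (hc0 : c ≤ 0)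
    (hne : casoratian (bRay ts3 n) j ≠ 0) : c ≤ padicValRat p (casoratian (bRay ts3 n) j) := by
  haveI : Fact p.Prime := ⟨hpr⟩
  have hb := inPolytope_ray n
  have hb' := inPolytope_shift_ts3_j hn j hj1 hj7
  have hv := casoratianClassBound_holds (bRay ts3 n) j p hb hj1 hj7 hb' hpr hp5 hwin hne
  by_cases hreal : ∃ x, x < p ∧ 2 ≤ classPoleCount (bRay ts3 n) p x ∧ classExp (bRay ts3 n) p x = -(N : ℤ)
  · have hO' := rungO_of_cover hb hj1 hj7 hb' hpr hp5 hpb hpd hwin hcov hN hodd hrange hO hreal hne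
    rcases casLB_ge_of_cover hcov hLB hB1 hpd with h0 | h
    · rw [h0] at hv; exact le_trans (by exact_mod_cast hc0) hv
    · linarith
  · rcases casLB_ge_of_cover_x hcov hLBx hB1' hpd hreal with h0 | h
    · rw [h0] at hv; exact le_trans (by exact_mod_cast hc0) hv
    · linarith

/-- **The Lemma-D bonus on the ray, any direction `j`** (`ClassTypeGuards.lemmaD_of_cover` with its fallback; `StairCoverKit.cover_J` is `j = 7`):
`c ≤ v_p(Cas_j(b(n)))` from a cover, `checkLB` at `(m, B)` with `c ≤ m + B + 1`, `checkJ` at `m`, fallback `checkLBx` at `(m; A', B')` with `c ≤ A' + B'`. -/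
theorem cover_J_ts3 {n p j : ℕ} (hn : 1 ≤ n) (hj1 : 1 ≤ j) (hj7 : j ≤ 7) (hpr : p.Prime)
    (hp5 : 5 ≤ p) (hpb : (p : ℤ) ≤ bRay ts3 n 0) (hpd : (p : ℤ) ≤ dOf (bRay ts3 n)) (hwin : (bRay ts3 n 0 + 2 : ℤ) < (p : ℤ) ^ 2)
    {TY : List (List ℤ × Bool)} (hcov : Cover (bRay ts3 n) p TY) {m B A' B' c : ℤ}
    (hLB : checkLB (decide (¬ (2 : ℤ) ∣ bRay ts3 n 0)) TY m B = true) (hB1 : B ≤ 1)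
    (hJ : checkJ (decide (¬ (2 : ℤ) ∣ bRay ts3 n 0)) TY m = true)
    (hLBx : checkLBx (decide (¬ (2 : ℤ) ∣ bRay ts3 n 0)) TY m A' B' = true) (hB1' : B' ≤ 1)
    (hc : c ≤ m + B + 1) (hc' : c ≤ A' + B') (hc0 : c ≤ 0)
    (hne : casoratian (bRay ts3 n) j ≠ 0) : c ≤ padicValRat p (casoratian (bRay ts3 n) j) := by
  haveI : Fact p.Prime := ⟨hpr⟩
  have hb := inPolytope_ray n
  have hb' := inPolytope_shift_ts3_j hn j hj1 hj7
  have hv := casoratianClassBound_holds (bRay ts3 n) j p hb hj1 hj7 hb' hpr hp5 hwin hne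
  by_cases hreal : ∃ x, x < p ∧ 2 ≤ classPoleCount (bRay ts3 n) p x ∧ classExp (bRay ts3 n) p x = m
  · have hJ' := lemmaD_of_cover hb hj1 hj7 hb' hpr hp5 hpb hpd hwin hcov hJ hreal hne
    rcases casLB_ge_of_cover hcov hLB hB1 hpd with h0 | h
    · rw [h0] at hv; exact le_trans (by exact_mod_cast hc0) hv
    · linarith
  · rcases casLB_ge_of_cover_x hcov hLBx hB1' hpd hreal with h0 | h
    · rw [h0] at hv; exact le_trans (by exact_mod_cast hc0) hv
    · linarith

/-- **The double-drop cell `85n < 3p ≤ 90n`, any `j`**: `v_p(Cas_j(b(n))) ≥ −7 = casLB + 2` (`N = 6`; parity-split covers `cover_c28b_ev/od`; the even-`n` checks are TOP_STAIR #1's `StairTS1.checkB_c11b`, same type list). -/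
theorem cas_ge_c28b {n j p : ℕ} (hn : 1 ≤ n) (hj1 : 1 ≤ j) (hj7 : j ≤ 7) (hprime : p.Prime) (hA : 85 * n < 3 * p) (hB : p ≤ 30 * n)
    (hcas : casoratian (bRay ts3 n) j ≠ 0) :
    (-7 : ℤ) ≤ padicValRat p (casoratian (bRay ts3 n) j) := by
  haveI : Fact p.Prime := ⟨hprime⟩
  have hp2 : p % 2 = 1 := odd_of_prime_gt43 hprime (by omega) hn
  obtain ⟨hp5, hwin⟩ := window43 hn (show 43 * n < 2 * p by omega)
  by_cases hn2 : n % 2 = 0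
  · obtain ⟨h1, h2, h3⟩ := StairTS1.checkB_c11b
    exact cover_B_j (inPolytope_ray n) hj1 hj7 (inPolytope_shift_ts3_j hn j hj1 hj7) hprime hp5 (le_b0_ts3 (by omega)) (le_dOf_ts3 (by omega)) hwin
      (cover_c28b_ev hA (by omega) hp2 hn2) (N := 6) (by norm_num) (by decide)
      (by rw [oddFlag_even hn2]; exact h1) (by norm_num) (by rw [oddFlag_even hn2]; exact h2) (by rw [oddFlag_even hn2]; exact h3)
      (by norm_num) (by norm_num) (by norm_num) (by norm_num) hcas
  · have hn1 : n % 2 = 1 := by omega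
    obtain ⟨h1, h2, h3⟩ := checkB_c28b_od
    exact cover_B_j (inPolytope_ray n) hj1 hj7 (inPolytope_shift_ts3_j hn j hj1 hj7) hprime hp5 (le_b0_ts3 (by omega)) (le_dOf_ts3 (by omega)) hwin
      (cover_c28b_od hA (by omega) hp2 hn1) (N := 6) (by norm_num) (by decide)
      (by rw [oddFlag_odd hn1]; exact h1) (by norm_num) (by rw [oddFlag_odd hn1]; exact h2) (by rw [oddFlag_odd hn1]; exact h3)
      (by norm_num) (by norm_num) (by norm_num) (by norm_num) hcas

/-- **The double-drop cell `30n < p ≤ 31n`, any `j`**: `v_p(Cas_j(b(n))) ≥ −7 = casLB + 2` (`N = 6`; parity-split covers `cover_c30_ev/od`). -/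
theorem cas_ge_c30 {n j p : ℕ} (hn : 1 ≤ n) (hj1 : 1 ≤ j) (hj7 : j ≤ 7) (hprime : p.Prime) (hA : 30 * n < p) (hB : p ≤ 31 * n)
    (hcas : casoratian (bRay ts3 n) j ≠ 0) :
    (-7 : ℤ) ≤ padicValRat p (casoratian (bRay ts3 n) j) := by
  haveI : Fact p.Prime := ⟨hprime⟩
  have hp2 : p % 2 = 1 := odd_of_prime_gt43 hprime (by omega) hn
  obtain ⟨hp5, hwin⟩ := window43 hn (show 43 * n < 2 * p by omega)
  by_cases hn2 : n % 2 = 0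
  · obtain ⟨h1, h2, h3⟩ := checkB_c30_ev
    exact cover_B_j (inPolytope_ray n) hj1 hj7 (inPolytope_shift_ts3_j hn j hj1 hj7) hprime hp5 (le_b0_ts3 (by omega)) (le_dOf_ts3 (by omega)) hwin
      (cover_c30_ev (by omega) (by omega) hp2 hn2) (N := 6) (by norm_num) (by decide)
      (by rw [oddFlag_even hn2]; exact h1) (by norm_num) (by rw [oddFlag_even hn2]; exact h2) (by rw [oddFlag_even hn2]; exact h3)
      (by norm_num) (by norm_num) (by norm_num) (by norm_num) hcas
  · have hn1 : n % 2 = 1 := by omega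
    obtain ⟨h1, h2, h3⟩ := checkB_c30_od
    exact cover_B_j (inPolytope_ray n) hj1 hj7 (inPolytope_shift_ts3_j hn j hj1 hj7) hprime hp5 (le_b0_ts3 (by omega)) (le_dOf_ts3 (by omega)) hwin
      (cover_c30_od (by omega) (by omega) hp2 hn1) (N := 6) (by norm_num) (by decide)
      (by rw [oddFlag_odd hn1]; exact h1) (by norm_num) (by rw [oddFlag_odd hn1]; exact h2) (by rw [oddFlag_odd hn1]; exact h3)
      (by norm_num) (by norm_num) (by norm_num) (by norm_num) hcas

/-- **The collinearity cell `31n < p ≤ 32n`, any `j`**: `v_p(Cas_j(b(n))) ≥ −6 = casLB + 1` (`N = 5`, keys `[−1,−4]`, `[−2,−3]`; the moment range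
`4p + 2 ≤ 2d + 3 = 128n + 3` holds on the cell). -/
theorem cas_ge_c31 {n j p : ℕ} (hn : 1 ≤ n) (hj1 : 1 ≤ j) (hj7 : j ≤ 7) (hprime : p.Prime) (hA : 31 * n < p) (hB : p ≤ 32 * n)
    (hcas : casoratian (bRay ts3 n) j ≠ 0) :
    (-6 : ℤ) ≤ padicValRat p (casoratian (bRay ts3 n) j) := by
  haveI : Fact p.Prime := ⟨hprime⟩
  have hp2 : p % 2 = 1 := odd_of_prime_gt43 hprime (by omega) hn
  obtain ⟨hp5, hwin⟩ := window43 hn (show 43 * n < 2 * p by omega)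
  obtain ⟨h1, h2, h3⟩ := checkO_c31 (decide (¬ (2 : ℤ) ∣ bRay ts3 n 0))
  have hrange : ((5 : ℕ) - 1 : ℤ) * p + 2 ≤ 2 * dOf (bRay ts3 n) + 3 := by
    rw [dOf_ts3]; push_cast
    have : (p : ℤ) ≤ 32 * n := by exact_mod_cast hB
    linarith
  exact cover_O_ts3 hn hj1 hj7 hprime hp5 (le_b0_ts3 (by omega)) (le_dOf_ts3 (by omega)) hwin
    (cover_c31 (by omega) (by omega) hp2) (N := 5) (by norm_num) (by norm_num) hrange
    h1 (by norm_num) h2 h3 (by norm_num) (by norm_num) (by norm_num) (by norm_num) hcas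

/-- **The Lemma-D cell `35n < p ≤ 36n`, any `j`**: `v_p(Cas_j(b(n))) ≥ −4 = casLB + 1` (`m = −4`; the STAIR cell of `StairCellTS3b`, closed, every `j`). -/
theorem cas_ge_c35 {n j p : ℕ} (hn : 1 ≤ n) (hj1 : 1 ≤ j) (hj7 : j ≤ 7) (hprime : p.Prime) (hA : 35 * n < p) (hB : p ≤ 36 * n)
    (hcas : casoratian (bRay ts3 n) j ≠ 0) :
    (-4 : ℤ) ≤ padicValRat p (casoratian (bRay ts3 n) j) := by
  haveI : Fact p.Prime := ⟨hprime⟩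
  have hp2 : p % 2 = 1 := odd_of_prime_gt43 hprime (by omega) hn
  obtain ⟨hp5, hwin⟩ := window43 hn (show 43 * n < 2 * p by omega)
  obtain ⟨h1, h2, h3⟩ := checkJ_c35 (decide (¬ (2 : ℤ) ∣ bRay ts3 n 0))
  exact cover_J_ts3 hn hj1 hj7 hprime hp5 (le_b0_ts3 (by omega)) (le_dOf_ts3 (by omega)) hwin
    (cover_c35 (by omega) (by omega) hp2) h1 (by norm_num) h2 h3 (by norm_num) (by norm_num) (by norm_num) (by norm_num) hcas

end Summit.KontsevichZagierPeriods.Zeta5Search.StairTS3
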